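import Summits.AtomisticToContinuum.Crystallization.Theses.SpectralChargeLedger
import Summits.AtomisticToContinuum.Crystallization.Theorems.SpectralChargeLedgerShellsToLayersExactify
import Summits.AtomisticToContinuum.Crystallization.Theorems.SpectralChargeLedgerShellsToLayersLayering

/-!
# `SpectralChargeLedger.ShellsToLayers` (stmt-AtomisticToContinuum-17254) — PROVED
# (line `blowup-slot-layering`: blow up to `τ = 0` and land on the landed exact layering)

`shellsToLayers_proof : Summit.AtomisticToContinuum.Crystallization.Theses.SpectralChargeLedger.ShellsToLayers`.
The crux (pure geometry; rank 3 of route `SpectralChargeLedger`): for every relaxed Barlow cell `(a₀, h₀)` in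
the box, every `δ > 0` and every scale `(R, ε)` there are `τ ∈ (0, 1]` and `R'` such that a site of a finite
`δ`-separated configuration all of whose neighbours within `R'` have `13/10·a₀`-shells `τ`-matched (linear
isometry + bijection) to the hcp OR fcc 12-shell at scale `(a₀, h₀)` carries an `(R, ε)`-window of the
`LayeredWindows` format (spacing `a₀`, free Hägg word, increments in `[39a₀/50, 17a₀/20]`).

PROOF — contrapositive compactness in the local rubber topology (the quantifier order `∀ (R, ε) ∃ (τ, R')`,
certified load-bearing by the refuter's crux attack, is exactly its shape): `setForm` negates at fixed
`(a₀, h₀, δ, R, ε)` with tolerances `1/(k+1)` and radii `k+1`, recentres the offending sites at `0`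
(`good_two_preimage_add_const`), extracts a `δ`-separated local limit `Y ∋ 0`
(`exists_subseq_forall_eventually_ballMatch`, `HullExactShells.zero_mem_of_ballMatch`), and applies the three
landed stubs of the line — S1 `good_of_limit_two` / `stub_goodOfLimit` (…GoodOfLimit.lean: two-letter shell
congruence passes to local limits, so every point of `Y` is `η`-good for every `η > 0`), S2
`stub_exactOfForallGood` (…Exactify.lean: `∀ η`-goodness is exactness), S3 `stub_exactSlotLayering`
(…Layering.lean: everywhere-exact sets are exactly layered at spacing `a₀`, via the slot dictionary
`stub_templateShells` of …TemplateSlots.lean) — to get `Y = v + A(S(a₀, s, z))`; the ball match at radius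
`R + ‖v‖` hands the `(R, ε)`-window back to the `k`-th recentred set (`window_of_translate_ballMatch`,
translation `−v`) and to the original one (`window_of_window_preimage`, translation `−v − root`) —
contradiction. `shellsToLayers_proof` reads the set form back through `Set.range y`.

Line `Cruxes/ShellsToLayers/Lines/blowup_slot_layering.lean` (crux-strategist 2026-08-17, realising the crux
ideas `exact-blowup-slot-layering` / `local-limit-onto-landed-layering`); this file is the sorry-free skeleton
with its stubs discharged by the landed files. All `[folklore]` (Baake–Grimm 2013, Remark 5.6: local rubber
topology; Hales DSP 2012 §1.3). No definitions.
-/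

noncomputable section

namespace Summit.AtomisticToContinuum.Crystallization.Theorems.ShellsToLayers

open scoped Topology
open Filter Metric
open Literature.MathematicalPhysics.StatisticalMechanics
open Summit.AtomisticToContinuum.Crystallization.Theorems.HullExactShells

/-- Two-letter goodness is translation covariant (each disjunct through the landed
`HullExactShells.good_preimage_add_const`). [folklore] -/
theorem good_two_preimage_add_const {S P₁ P₂ : Set (EuclideanSpace ℝ (Fin 3))}
    {q : EuclideanSpace ℝ (Fin 3)} {r τ : ℝ} (c : EuclideanSpace ℝ (Fin 3))
    (h : ∃ A : EuclideanSpace ℝ (Fin 3) →ₗᵢ[ℝ] EuclideanSpace ℝ (Fin 3),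
      (∃ e : ↥{w | w ∈ S ∧ w ≠ q + c ∧ dist w (q + c) < r} ≃ ↥P₁,
        ∀ t : ↥{w | w ∈ S ∧ w ≠ q + c ∧ dist w (q + c) < r},
          dist ((t : EuclideanSpace ℝ (Fin 3)) - (q + c)) (A ((e t : ↥P₁) : EuclideanSpace ℝ (Fin 3))) ≤ τ) ∨
      (∃ e : ↥{w | w ∈ S ∧ w ≠ q + c ∧ dist w (q + c) < r} ≃ ↥P₂,
        ∀ t : ↥{w | w ∈ S ∧ w ≠ q + c ∧ dist w (q + c) < r},
          dist ((t : EuclideanSpace ℝ (Fin 3)) - (q + c)) (A ((e t : ↥P₂) : EuclideanSpace ℝ (Fin 3))) ≤ τ)) :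
    ∃ A : EuclideanSpace ℝ (Fin 3) →ₗᵢ[ℝ] EuclideanSpace ℝ (Fin 3),
      (∃ e : ↥{w | w ∈ (fun w => w + c) ⁻¹' S ∧ w ≠ q ∧ dist w q < r} ≃ ↥P₁,
        ∀ t : ↥{w | w ∈ (fun w => w + c) ⁻¹' S ∧ w ≠ q ∧ dist w q < r},
          dist ((t : EuclideanSpace ℝ (Fin 3)) - q) (A ((e t : ↥P₁) : EuclideanSpace ℝ (Fin 3))) ≤ τ) ∨
      (∃ e : ↥{w | w ∈ (fun w => w + c) ⁻¹' S ∧ w ≠ q ∧ dist w q < r} ≃ ↥P₂,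
        ∀ t : ↥{w | w ∈ (fun w => w + c) ⁻¹' S ∧ w ≠ q ∧ dist w q < r},
          dist ((t : EuclideanSpace ℝ (Fin 3)) - q) (A ((e t : ↥P₂) : EuclideanSpace ℝ (Fin 3))) ≤ τ) := by
  obtain ⟨A, hA | hA⟩ := h
  · obtain ⟨A', e', h'⟩ := good_preimage_add_const (X := S) (P := P₁) (z := q) (r := r) (η := τ) c ⟨A, hA⟩
    exact ⟨A', Or.inl ⟨e', h'⟩⟩
  · obtain ⟨A', e', h'⟩ := good_preimage_add_const (X := S) (P := P₂) (z := q) (r := r) (η := τ) c ⟨A, hA⟩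
    exact ⟨A', Or.inr ⟨e', h'⟩⟩

/-- **Window transfer along a ball match.** If `Y = L + v` is two-way `ε`-matched with `Y'` on the ball of
radius `R + ‖v‖` about `0`, then `Y'` translated by `−v` is two-way `ε`-matched with `L` on `B(0, R)`.
[folklore] -/
theorem window_of_translate_ballMatch {R ε : ℝ} {L Y Y' : Set (EuclideanSpace ℝ (Fin 3))}
    {v : EuclideanSpace ℝ (Fin 3)} (hY : Y = (fun q => q + v) '' L) (hM : BallMatch ε (R + ‖v‖) 0 Y' Y) :
    (∀ p ∈ L, ‖p‖ ≤ R → ∃ q ∈ Y', dist (q + -v) p ≤ ε) ∧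
    (∀ q ∈ Y', ‖q + -v‖ ≤ R → ∃ p ∈ L, dist (q + -v) p ≤ ε) := by
  constructor
  · intro p hp hpR
    have hpv : p + v ∈ Y := by rw [hY]; exact ⟨p, hp, rfl⟩
    have hR' : dist (p + v) 0 ≤ R + ‖v‖ := by
      rw [dist_zero_right]; exact (norm_add_le p v).trans (by linarith)
    obtain ⟨a, ha, hap⟩ := hM.1 (p + v) hpv hR'
    refine ⟨a, ha, ?_⟩
    have e1 : dist (a + -v) p = dist a (p + v) := by
      rw [← dist_add_right (a + -v) p v]; congr 1; abel
    rw [e1]; exact hap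
  · intro q hq hqR
    have hR' : dist q 0 ≤ R + ‖v‖ := by
      rw [dist_zero_right]
      have h1 : ‖q‖ ≤ ‖q + -v‖ + ‖v‖ :=
        calc ‖q‖ = ‖(q + -v) + v‖ := by congr 1; abel
          _ ≤ ‖q + -v‖ + ‖v‖ := norm_add_le _ _
      linarith
    obtain ⟨y, hy, hqy⟩ := hM.2 q hq hR'
    rw [hY] at hy
    obtain ⟨p, hp, rfl⟩ := hy
    refine ⟨p, hp, ?_⟩
    have e1 : dist (q + -v) p = dist q (p + v) := by
      rw [← dist_add_right (q + -v) p v]; congr 1; abel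
    rw [e1]; exact hqy

/-- **Windows are translation covariant**: a two-way match of `(S − c) + t` with `L` on `B(0, R)` is a two-way
match of `S + (t − c)` with `L`. [folklore] -/
theorem window_of_window_preimage {R ε : ℝ} {L S : Set (EuclideanSpace ℝ (Fin 3))}
    (c t : EuclideanSpace ℝ (Fin 3))
    (h1 : ∀ p ∈ L, ‖p‖ ≤ R → ∃ q ∈ (fun w => w + c) ⁻¹' S, dist (q + t) p ≤ ε)
    (h2 : ∀ q ∈ (fun w => w + c) ⁻¹' S, ‖q + t‖ ≤ R → ∃ p ∈ L, dist (q + t) p ≤ ε) :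
    (∀ p ∈ L, ‖p‖ ≤ R → ∃ q ∈ S, dist (q + (t - c)) p ≤ ε) ∧
    (∀ q ∈ S, ‖q + (t - c)‖ ≤ R → ∃ p ∈ L, dist (q + (t - c)) p ≤ ε) := by
  constructor
  · intro p hp hpR
    obtain ⟨q, hq, hqp⟩ := h1 p hp hpR
    refine ⟨q + c, hq, ?_⟩
    have e1 : q + c + (t - c) = q + t := by abel
    rw [e1]; exact hqp
  · intro q hq hqR
    have hq' : q - c ∈ (fun w => w + c) ⁻¹' S := by
      show q - c + c ∈ S
      rw [sub_add_cancel]; exact hq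
    have e1 : q - c + t = q + (t - c) := by abel
    obtain ⟨p, hp, hpq⟩ := h2 (q - c) hq' (by rw [e1]; exact hqR)
    exact ⟨p, hp, by rw [← e1]; exact hpq⟩

/-- **The set form of the crux (contrapositive compactness).** For every cell in the box, every `δ > 0` and
every `(R, ε)` there are `τ ∈ (0, 1]` and `R'` such that every `δ`-separated SET all of whose points within `R'`
of a point `p` of it are `τ`-good carries an `(R, ε)`-window. [folklore] -/
theorem setForm (a₀ h₀ : ℝ) (ha : 47 / 50 ≤ a₀) (ha' : a₀ ≤ 1) (hh : |h₀ - a₀ * Real.sqrt (2 / 3)| ≤ a₀ / 100)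
    (δ : ℝ) (hδ : 0 < δ) (R ε : ℝ) (hε : 0 < ε) :
    ∃ τ R' : ℝ, 0 < τ ∧ τ ≤ 1 ∧ ∀ S : Set (EuclideanSpace ℝ (Fin 3)),
      (∀ p ∈ S, ∀ q ∈ S, p ≠ q → δ ≤ dist p q) → ∀ p ∈ S,
        (∀ q ∈ S, dist q p ≤ R' → ∃ A : EuclideanSpace ℝ (Fin 3) →ₗᵢ[ℝ] EuclideanSpace ℝ (Fin 3),
            (∃ e : ↥{z : EuclideanSpace ℝ (Fin 3) | z ∈ S ∧ z ≠ q ∧ dist z q < 13 / 10 * a₀} ≃ ↥{q : EuclideanSpace ℝ (Fin 3) | q ∈ hcpStacking a₀ h₀ ∧ q ≠ 0 ∧ ‖q‖ < 13 / 10 * a₀}, ∀ t : ↥{z : EuclideanSpace ℝ (Fin 3) | z ∈ S ∧ z ≠ q ∧ dist z q < 13 / 10 * a₀}, dist ((t : EuclideanSpace ℝ (Fin 3)) - q) (A ((e t : ↥{q : EuclideanSpace ℝ (Fin 3) | q ∈ hcpStacking a₀ h₀ ∧ q ≠ 0 ∧ ‖q‖ < 13 / 10 * a₀}) : EuclideanSpace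 ℝ (Fin 3))) ≤ τ) ∨
            (∃ e : ↥{z : EuclideanSpace ℝ (Fin 3) | z ∈ S ∧ z ≠ q ∧ dist z q < 13 / 10 * a₀} ≃ ↥{q : EuclideanSpace ℝ (Fin 3) | q ∈ fccStacking a₀ h₀ ∧ q ≠ 0 ∧ ‖q‖ < 13 / 10 * a₀}, ∀ t : ↥{z : EuclideanSpace ℝ (Fin 3) | z ∈ S ∧ z ≠ q ∧ dist z q < 13 / 10 * a₀}, dist ((t : EuclideanSpace ℝ (Fin 3)) - q) (A ((e t : ↥{q : EuclideanSpace ℝ (Fin 3) | q ∈ fccStacking a₀ h₀ ∧ q ≠ 0 ∧ ‖q‖ < 13 / 10 * a₀}) : EuclideanSpace ℝ (Fin 3))) ≤ τ)) →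
        ∃ (A : EuclideanSpace ℝ (Fin 3) →ₗᵢ[ℝ] EuclideanSpace ℝ (Fin 3)) (t : EuclideanSpace ℝ (Fin 3)) (s : ℤ → ℤ) (z : ℤ → ℝ),
          IsHaggSeq s ∧ (∀ m : ℤ, 39 / 50 * a₀ ≤ z (m + 1) - z m ∧ z (m + 1) - z m ≤ 17 / 20 * a₀) ∧
          (∀ p ∈ {q : EuclideanSpace ℝ (Fin 3) | ∃ m i j : ℤ, q = A (((i : ℝ) • triangularVec₁ a₀) + ((j : ℝ) • triangularVec₂ a₀) + ((haggLabel s m : ℝ) • barlowOffset a₀) + (z m • layerNormal 1))},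
            ‖p‖ ≤ R → ∃ q ∈ S, dist (q + t) p ≤ ε) ∧
          (∀ q ∈ S, ‖q + t‖ ≤ R → ∃ p ∈ {q : EuclideanSpace ℝ (Fin 3) | ∃ m i j : ℤ, q = A (((i : ℝ) • triangularVec₁ a₀) + ((j : ℝ) • triangularVec₂ a₀) + ((haggLabel s m : ℝ) • barlowOffset a₀) + (z m • layerNormal 1))},
            dist (q + t) p ≤ ε) := by
  classical
  obtain ⟨ha0, hlo, -⟩ := inBox_bounds ha hh
  have hh0 : 0 < h₀ := by linarith
  by_contra hcon
  -- a failing family: tolerance `1/(k+1)`, radius `k+1`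
  have hbad : ∀ k : ℕ, ∃ (S : Set (EuclideanSpace ℝ (Fin 3))) (c : EuclideanSpace ℝ (Fin 3)),
      (∀ p ∈ S, ∀ q ∈ S, p ≠ q → δ ≤ dist p q) ∧ c ∈ S ∧
      (∀ q ∈ S, dist q c ≤ (k : ℝ) + 1 → ∃ A : EuclideanSpace ℝ (Fin 3) →ₗᵢ[ℝ] EuclideanSpace ℝ (Fin 3),
          (∃ e : ↥{z : EuclideanSpace ℝ (Fin 3) | z ∈ S ∧ z ≠ q ∧ dist z q < 13 / 10 * a₀} ≃ ↥{q : EuclideanSpace ℝ (Fin 3) | q ∈ hcpStacking a₀ h₀ ∧ q ≠ 0 ∧ ‖q‖ < 13 / 10 * a₀}, ∀ t : ↥{z : EuclideanSpace ℝ (Fin 3) | z ∈ S ∧ z ≠ q ∧ dist z q < 13 / 10 * a₀}, dist ((t : EuclideanSpace ℝ (Fin 3)) - q) (A ((e t : ↥{q : EuclideanSpace ℝ (Fin 3) | q ∈ hcpStacking a₀ h₀ ∧ q ≠ 0 ∧ ‖q‖ < 13 / 10 * a₀}) : EuclideanSpace ℝ (Fin 3))) ≤ 1 / ((k : ℝ)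 + 1)) ∨
          (∃ e : ↥{z : EuclideanSpace ℝ (Fin 3) | z ∈ S ∧ z ≠ q ∧ dist z q < 13 / 10 * a₀} ≃ ↥{q : EuclideanSpace ℝ (Fin 3) | q ∈ fccStacking a₀ h₀ ∧ q ≠ 0 ∧ ‖q‖ < 13 / 10 * a₀}, ∀ t : ↥{z : EuclideanSpace ℝ (Fin 3) | z ∈ S ∧ z ≠ q ∧ dist z q < 13 / 10 * a₀}, dist ((t : EuclideanSpace ℝ (Fin 3)) - q) (A ((e t : ↥{q : EuclideanSpace ℝ (Fin 3) | q ∈ fccStacking a₀ h₀ ∧ q ≠ 0 ∧ ‖q‖ < 13 / 10 * a₀}) : EuclideanSpace ℝ (Fin 3))) ≤ 1 / ((k : ℝ) + 1))) ∧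
      ¬ (∃ (A : EuclideanSpace ℝ (Fin 3) →ₗᵢ[ℝ] EuclideanSpace ℝ (Fin 3)) (t : EuclideanSpace ℝ (Fin 3)) (s : ℤ → ℤ) (z : ℤ → ℝ),
          IsHaggSeq s ∧ (∀ m : ℤ, 39 / 50 * a₀ ≤ z (m + 1) - z m ∧ z (m + 1) - z m ≤ 17 / 20 * a₀) ∧
          (∀ p ∈ {q : EuclideanSpace ℝ (Fin 3) | ∃ m i j : ℤ, q = A (((i : ℝ) • triangularVec₁ a₀) + ((j : ℝ) • triangularVec₂ a₀) + ((haggLabel s m : ℝ) • barlowOffset a₀) + (z m • layerNormal 1))},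
            ‖p‖ ≤ R → ∃ q ∈ S, dist (q + t) p ≤ ε) ∧
          (∀ q ∈ S, ‖q + t‖ ≤ R → ∃ p ∈ {q : EuclideanSpace ℝ (Fin 3) | ∃ m i j : ℤ, q = A (((i : ℝ) • triangularVec₁ a₀) + ((j : ℝ) • triangularVec₂ a₀) + ((haggLabel s m : ℝ) • barlowOffset a₀) + (z m • layerNormal 1))},
            dist (q + t) p ≤ ε)) := by
    intro k
    by_contra hk
    apply hcon
    refine ⟨1 / ((k : ℝ) + 1), (k : ℝ) + 1, by positivity, ?_, ?_⟩
    · rw [div_le_one (by positivity)]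
      have h0 : (0 : ℝ) ≤ k := Nat.cast_nonneg k
      linarith
    · intro S hsep c hc hgood
      by_contra hw
      exact hk ⟨S, c, hsep, hc, hgood, hw⟩
  choose S c hSsep hcS hSgood hSwin using hbad
  -- recentre the roots at the origin
  set Ys : ℕ → Set (EuclideanSpace ℝ (Fin 3)) := fun k => (fun w => w + c k) ⁻¹' S k with hYs
  have hYsep : ∀ k, ∀ p ∈ Ys k, ∀ q ∈ Ys k, p ≠ q → δ ≤ dist p q := fun k =>
    sep_preimage_add_const (hSsep k) (c k)
  have h0 : ∀ k, (0 : EuclideanSpace ℝ (Fin 3)) ∈ Ys k := fun k => by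
    show (0 : EuclideanSpace ℝ (Fin 3)) + c k ∈ S k
    rw [zero_add]; exact hcS k
  have hYgood : ∀ k, ∀ q ∈ Ys k, ‖q‖ ≤ (k : ℝ) + 1 → ∃ A : EuclideanSpace ℝ (Fin 3) →ₗᵢ[ℝ] EuclideanSpace ℝ (Fin 3),
        (∃ e : ↥{z : EuclideanSpace ℝ (Fin 3) | z ∈ Ys k ∧ z ≠ q ∧ dist z q < 13 / 10 * a₀} ≃ ↥{q : EuclideanSpace ℝ (Fin 3) | q ∈ hcpStacking a₀ h₀ ∧ q ≠ 0 ∧ ‖q‖ < 13 / 10 * a₀}, ∀ t : ↥{z : EuclideanSpace ℝ (Fin 3) | z ∈ Ys k ∧ z ≠ q ∧ dist z q < 13 / 10 * a₀}, dist ((t : EuclideanSpace ℝ (Fin 3)) - q) (A ((e t : ↥{q : EuclideanSpace ℝ (Fin 3) | q ∈ hcpStacking a₀ h₀ ∧ q ≠ 0 ∧ ‖q‖ < 13 / 10 * a₀}) : EuclideanSpace ℝ (Fin 3))) ≤ 1 / ((k : ℝ) + 1)) ∨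
        (∃ e : ↥{z : EuclideanSpace ℝ (Fin 3) | z ∈ Ys k ∧ z ≠ q ∧ dist z q < 13 / 10 * a₀} ≃ ↥{q : EuclideanSpace ℝ (Fin 3) | q ∈ fccStacking a₀ h₀ ∧ q ≠ 0 ∧ ‖q‖ < 13 / 10 * a₀}, ∀ t : ↥{z : EuclideanSpace ℝ (Fin 3) | z ∈ Ys k ∧ z ≠ q ∧ dist z q < 13 / 10 * a₀}, dist ((t : EuclideanSpace ℝ (Fin 3)) - q) (A ((e t : ↥{q : EuclideanSpace ℝ (Fin 3) | q ∈ fccStacking a₀ h₀ ∧ q ≠ 0 ∧ ‖q‖ < 13 / 10 * a₀}) : EuclideanSpace ℝ (Fin 3))) ≤ 1 / ((k : ℝ) + 1)) := by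
    intro k q hq hqn
    apply good_two_preimage_add_const
    apply hSgood k (q + c k) hq
    rw [dist_eq_norm, add_sub_cancel_right]; exact hqn
  -- local limit in the local rubber topology
  obtain ⟨φ, Y, hφ, hYsep', hlim⟩ := exists_subseq_forall_eventually_ballMatch hδ Ys hYsep
  have h0Y : (0 : EuclideanSpace ℝ (Fin 3)) ∈ Y :=
    zero_mem_of_ballMatch hδ hYsep' (Eventually.of_forall fun k => h0 (φ k)) hlim
  have hτ : Tendsto (fun k => 1 / (((φ k : ℕ) : ℝ) + 1)) atTop (𝓝 0) :=
    (tendsto_one_div_add_atTop_nhds_zero_nat (𝕜 := ℝ)).comp hφ.tendsto_atTop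
  have hρ : Tendsto (fun k => ((φ k : ℕ) : ℝ) + 1) atTop atTop :=
    tendsto_atTop_add_const_right _ 1 (tendsto_natCast_atTop_atTop.comp hφ.tendsto_atTop)
  -- S1: every point of the limit is good for every tolerance
  have hgoodY : ∀ p ∈ Y, ∀ η : ℝ, 0 < η → ∃ A : EuclideanSpace ℝ (Fin 3) →ₗᵢ[ℝ] EuclideanSpace ℝ (Fin 3),
        (∃ e : ↥{z : EuclideanSpace ℝ (Fin 3) | z ∈ Y ∧ z ≠ p ∧ dist z p < 13 / 10 * a₀} ≃ ↥{q : EuclideanSpace ℝ (Fin 3) | q ∈ hcpStacking a₀ h₀ ∧ q ≠ 0 ∧ ‖q‖ < 13 / 10 * a₀}, ∀ t : ↥{z : EuclideanSpace ℝ (Fin 3) | z ∈ Y ∧ z ≠ p ∧ dist z p < 13 / 10 * a₀}, dist ((t : EuclideanSpace ℝ (Fin 3)) - p) (A ((e t : ↥{q : EuclideanSpace ℝ (Fin 3) | q ∈ hcpStacking a₀ h₀ ∧ q ≠ 0 ∧ ‖q‖ < 13 / 10 * a₀}) : EuclideanSpace ℝ (Fin 3))) ≤ η) ∨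
        (∃ e : ↥{z : EuclideanSpace ℝ (Fin 3) | z ∈ Y ∧ z ≠ p ∧ dist z p < 13 / 10 * a₀} ≃ ↥{q : EuclideanSpace ℝ (Fin 3) | q ∈ fccStacking a₀ h₀ ∧ q ≠ 0 ∧ ‖q‖ < 13 / 10 * a₀}, ∀ t : ↥{z : EuclideanSpace ℝ (Fin 3) | z ∈ Y ∧ z ≠ p ∧ dist z p < 13 / 10 * a₀}, dist ((t : EuclideanSpace ℝ (Fin 3)) - p) (A ((e t : ↥{q : EuclideanSpace ℝ (Fin 3) | q ∈ fccStacking a₀ h₀ ∧ q ≠ 0 ∧ ‖q‖ < 13 / 10 * a₀}) : EuclideanSpace ℝ (Fin 3))) ≤ η) :=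
    stub_goodOfLimit a₀ h₀ δ ha ha' hh hδ (fun k => Ys (φ k)) Y (fun k => 1 / (((φ k : ℕ) : ℝ) + 1))
      (fun k => ((φ k : ℕ) : ℝ) + 1) (fun k => hYsep (φ k)) hYsep' (fun k => hYgood (φ k)) hτ hρ hlim
  -- S2: hence exact; S3: hence exactly layered
  have hexact := fun p hp => stub_exactOfForallGood a₀ h₀ δ ha ha' hh hδ Y hYsep' p hp (hgoodY p hp)
  obtain ⟨A, s, z, v, hs, hz, hYeq⟩ := stub_exactSlotLayering a₀ h₀ ha ha' hh Y ⟨0, h0Y⟩ hexact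
  -- transfer the window back along the ball match
  obtain ⟨k, hk⟩ := (hlim (R + ‖v‖) ε hε).exists
  obtain ⟨h1, h2⟩ := window_of_translate_ballMatch (R := R) hYeq hk
  obtain ⟨h1', h2'⟩ := window_of_window_preimage (c (φ k)) (-v) h1 h2
  exact hSwin (φ k) ⟨A, -v - c (φ k), s, z, hs, hz, h1', h2'⟩

/-- **`SpectralChargeLedger.ShellsToLayers` (stmt-AtomisticToContinuum-17254), PROVED**: `τ`-good hcp/fcc shells on
a large ball give an `(R, ε)`-window of the `LayeredWindows` format — the set form `setForm` read back through
`Set.range y`. [folklore] -/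
theorem shellsToLayers_proof :
    Summit.AtomisticToContinuum.Crystallization.Theses.SpectralChargeLedger.ShellsToLayers := by
  intro a₀ h₀ ha ha' hh δ hδ R ε hε
  obtain ⟨τ, R', hτ, hτ1, hmain⟩ := setForm a₀ h₀ ha ha' hh δ hδ R ε hε
  refine ⟨τ, R', hτ, hτ1, fun N y hsep i hgood => ?_⟩
  have hsepS : ∀ p ∈ Set.range y, ∀ q ∈ Set.range y, p ≠ q → δ ≤ dist p q := by
    rintro _ ⟨k, rfl⟩ _ ⟨l, rfl⟩ hkl
    exact hsep k l fun h' => hkl (by rw [h'])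
  obtain ⟨A, t, s, z, hs, hz, h1', h2'⟩ :=
    hmain (Set.range y) hsepS (y i) (Set.mem_range_self i) (by
      rintro _ ⟨j, rfl⟩ hj
      exact hgood j hj)
  refine ⟨A, t, s, z, hs, hz, ?_, ?_⟩
  · intro p hp hpR
    obtain ⟨_, ⟨k, rfl⟩, hk⟩ := h1' p hp hpR
    exact ⟨k, hk⟩
  · intro k hk
    obtain ⟨p, hp, hpk⟩ := h2' (y k) (Set.mem_range_self k) hk
    exact ⟨p, hp, hpk⟩

end Summit.AtomisticToContinuum.Crystallization.Theorems.ShellsToLayers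

end
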